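import Mathlib.Probability.ProductMeasure
import Literature.Probability.Percolation.Percolation
import Literature.Probability.Percolation.PercolationEvents
import Literature.Probability.Percolation.SitePercolationMeasure
import HarnessLib

/-!
# Site percolation: transport of connection events, lattice symmetries of `ℤ^d`, exit lemma, boxes

Topic `Literature/Probability/Percolation`. Sorry-free API over `Percolation.lean` (`siteConnIn`,
`siteOpenGraph`, `sitePercolatesAt`, `siteTheta`), `PercolationEvents.lean` (`DeterminedBy`),
`SitePercolationMeasure.lean` (`SiteConfig.relabel`, `sitePercolation_real_preimage_relabel`,
`sitePercolation_real_subset`, `sitePercolation_harris`) and `LatticeGraph.lean` /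
`ThermodynamicLimit.lean` (`zdGraph`, `Site.shift`, `innerBoundary`, `box`). Written for the
tree-side assembly of Cerf 2015, Theorem 1.3 (`Literature.Probability.Percolation.Cerf2015_thm_1_3`,
`CerfBoxLRO.lean` / `CerfTwoArms.lean`), whose §10 uses exactly these elementary facts —
lattice symmetry of connection probabilities, FKG gluing of connections,
`θ(p) ≤ Σ_{x∈∂ⁱⁿΛ(n)} P(0 ⟷ x in Λ(n))` and `|∂ⁱⁿΛ(n)| ≤ 2d(2n+1)^{d−1}` (p. 15) — but generally
useful. Everything is standard (Grimmett, *Percolation* (1999), §§1.6, 2.2) and tagged `[folklore]`.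

## Contents

* Transport of connection events along graph homomorphisms / isomorphisms: `siteOpenGraphHom`,
  `siteConnIn_map`, `relabel_mem_siteConnIn_iff`, and
  **`sitePercolation_real_siteConnIn_iso`**: `P_p(φ x ⟷ φ y in φ '' S) = P_p(x ⟷ y in S)` for
  `φ : G ≃g G'` (from `sitePercolation_real_preimage_relabel`).
* Automorphisms of `ℤ^d`: translations `zdShiftIso v` and signed coordinate permutations
  `Site.signedPerm π ε` / `zdSignedPermIso π ε` (they fix `0` and preserve `Λ(n)`:
  `signedPerm_image_box`; transitivity on signed axes: `exists_signedPerm_single`).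
* Connection events: increasing (`siteConnIn_isUpperSet`), monotone in the constraint set
  (`siteConnIn_mono_set`), symmetric (`siteConnIn_comm`), reflexive / one-edge cases, **gluing**
  (`siteConnIn_trans`: `{x ⟷ y in S} ∩ {y ⟷ z in S'} ⊆ {x ⟷ z in T}` for `S, S' ⊆ T`), determined
  by the sites of `S` (`determinedBy_siteConnIn`, hence `measurableSet_siteConnIn` for finite `S`
  and eligibility for `sitePercolation_harris`).
* Exit lemma and union bound: `{|C(x)| = ∞} ⊆ ⋃_{b ∈ ∂ⁱⁿΛ} {x ⟷ b in Λ}`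
  (`sitePercolatesAt_subset_iUnion_siteConnIn`), `θ_x(p) ≤ Σ_{b∈∂ⁱⁿΛ} P_p(x ⟷ b in Λ)`
  (`siteTheta_le_sum_siteConnIn`) and its pigeonhole form
  (`exists_innerBoundary_siteConnIn_ge`).
* Boxes of `ℤ^d`: `Λ(n)` is connected through nearest-neighbour paths (`box_induce_reachable`),
  positivity `p^{|Λ(n)|} ≤ P_p(x ⟷ y in Λ(n))` (`pow_card_box_le_siteConnIn`), boundary sites lie
  on faces (`exists_eq_of_mem_innerBoundary_box`), `|∂ⁱⁿΛ(n)| ≤ 2d(2n+1)^{d−1}`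
  (`card_innerBoundary_box_le`), translates of boxes (`zdShiftIso_image_box`,
  `image_add_box_subset`).

Mathlib anchors: `SimpleGraph.induceHom`, `SimpleGraph.Reachable.map/mono`,
`SimpleGraph.Embedding.induce`, `SimpleGraph.reachable_iff_reflTransGen`,
`Fintype.card_piFinset`, `Finset.exists_le_of_sum_le`, `measureReal_biUnion_finset_le`.

## References

* G. Grimmett, *Percolation*, 2nd ed., Springer 1999, §1.6 (site percolation), §2.2 ((2.7): the
  standard FKG gluing of connections).
* R. Cerf, Ann. Probab. 43 (2015) 2458–2480, arXiv:1306.3105, §10, p. 15 (where these facts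
  are used).
-/

noncomputable section

noncomputable section

namespace Literature.Probability.Percolation

open MeasureTheory ProbabilityTheory
open scoped ProbabilityTheory ENNReal

variable {V W : Type*}

/-! ### Transport of connection events along graph homomorphisms -/

section Transport

variable {G : SimpleGraph V} {G' : SimpleGraph W}

/-- A graph homomorphism mapping open sites of `ω` to open sites of `ω'` is a homomorphism of the
open subgraphs. [folklore] -/
def siteOpenGraphHom (f : G →g G') (ω : SiteConfig V) (ω' : SiteConfig W)
    (h : Set.MapsTo f ω ω') : siteOpenGraph G ω →g siteOpenGraph G' ω' where
  toFun := f
  map_rel' := by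
    intro a b hab
    rw [siteOpenGraph_adj] at hab ⊢
    exact ⟨f.map_rel hab.1, h hab.2.1, h hab.2.2⟩

/-- Connection events are pushed forward along graph homomorphisms compatible with the
configurations and the constraint sets. [folklore] -/
theorem siteConnIn_map (f : G →g G') {ω : SiteConfig V} {ω' : SiteConfig W}
    (h : Set.MapsTo f ω ω') {S : Set V} {S' : Set W} (hS : Set.MapsTo f S S') {x y : V}
    (hxy : ω ∈ siteConnIn G S x y) : ω' ∈ siteConnIn G' S' (f x) (f y) := by
  obtain ⟨hx, hy, hxS, hyS, hr⟩ := hxy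
  exact ⟨h hx, h hy, hS hxS, hS hyS,
    hr.map (SimpleGraph.induceHom (siteOpenGraphHom f ω ω' h) hS)⟩

/-- Under a graph isomorphism `φ`, `ω ∈ {x ⟷ y in S}` iff `φ '' ω ∈ {φ x ⟷ φ y in φ '' S}`.
[folklore] -/
theorem relabel_mem_siteConnIn_iff (φ : G ≃g G') (ω : SiteConfig V) (S : Set V) (x y : V) :
    SiteConfig.relabel φ.toEquiv ω ∈ siteConnIn G' (φ '' S) (φ x) (φ y) ↔
      ω ∈ siteConnIn G S x y := by
  rw [SiteConfig.relabel_apply]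
  constructor
  · intro h
    have hω : Set.MapsTo (φ.symm : G' →g G) (φ.toEquiv '' ω) ω := by
      rintro _ ⟨v, hv, rfl⟩
      change φ.toEquiv.symm (φ.toEquiv v) ∈ ω
      rwa [Equiv.symm_apply_apply]
    have hS : Set.MapsTo (φ.symm : G' →g G) (φ '' S) S := by
      rintro _ ⟨v, hv, rfl⟩
      change φ.toEquiv.symm (φ.toEquiv v) ∈ S
      rwa [Equiv.symm_apply_apply]
    have := siteConnIn_map (φ.symm : G' →g G) hω hS h
    change ω ∈ siteConnIn G S (φ.toEquiv.symm (φ.toEquiv x)) (φ.toEquiv.symm (φ.toEquiv y))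
      at this
    rwa [Equiv.symm_apply_apply, Equiv.symm_apply_apply] at this
  · intro h
    exact siteConnIn_map (φ : G →g G') (Set.mapsTo_image φ.toEquiv ω) (Set.mapsTo_image φ S) h

/-- Preimage form of `relabel_mem_siteConnIn_iff`. [folklore] -/
theorem relabel_preimage_siteConnIn (φ : G ≃g G') (S : Set V) (x y : V) :
    SiteConfig.relabel φ.toEquiv ⁻¹' siteConnIn G' (φ '' S) (φ x) (φ y) = siteConnIn G S x y :=
  Set.ext fun ω => relabel_mem_siteConnIn_iff φ ω S x y

/-- **Invariance of connection probabilities under graph isomorphisms**: for Bernoulli site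
percolation, `P_p(φ x ⟷ φ y in φ '' S) = P_p(x ⟷ y in S)`. [folklore] -/
theorem sitePercolation_real_siteConnIn_iso (φ : G ≃g G') (p : unitInterval) (S : Set V)
    (x y : V) :
    (sitePercolation W p).real (siteConnIn G' (φ '' S) (φ x) (φ y)) =
      (sitePercolation V p).real (siteConnIn G S x y) := by
  rw [← sitePercolation_real_preimage_relabel φ.toEquiv p, relabel_preimage_siteConnIn]

end Transport

/-! ### Automorphisms of `ℤ^d` -/

section ZdAut

variable {d : ℕ}

/-- Translation by `v` is an automorphism of the nearest-neighbour graph `ℤ^d`. [folklore] -/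
def zdShiftIso (v : LatticeModels.Site d) : LatticeModels.zdGraph d ≃g LatticeModels.zdGraph d where
  toEquiv := LatticeModels.Site.shift v
  map_rel_iff' := by
    intro a b
    exact LatticeModels.zdGraph_adj_shift_iff v a b

/-- `zdShiftIso v x = x + v`. [folklore] -/
@[simp] theorem zdShiftIso_apply (v x : LatticeModels.Site d) : zdShiftIso v x = x + v := rfl

/-- A signed coordinate permutation `x ↦ (i ↦ ε i * x (π⁻¹ i))` with signs `ε i = ±1`, as a
bijection of `ℤ^d` (the hyperoctahedral symmetries fixing the origin). [folklore] -/
def _root_.Literature.Probability.LatticeModels.Site.signedPerm (π : Equiv.Perm (Fin d)) (ε : Fin d → ℤˣ) : LatticeModels.Site d ≃ LatticeModels.Site d where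
  toFun x := fun i => (ε i : ℤ) * x (π.symm i)
  invFun y := fun j => (ε (π j) : ℤ) * y (π j)
  left_inv x := by
    funext j
    simp [← mul_assoc]
  right_inv y := by
    funext i
    simp [← mul_assoc]

/-- Coordinates of a signed permutation. [folklore] -/
@[simp] theorem _root_.Literature.Probability.LatticeModels.Site.signedPerm_apply (π : Equiv.Perm (Fin d)) (ε : Fin d → ℤˣ) (x : LatticeModels.Site d)
    (i : Fin d) : LatticeModels.Site.signedPerm π ε x i = (ε i : ℤ) * x (π.symm i) := rfl

/-- Coordinates of the inverse signed permutation. [folklore] -/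
@[simp] theorem _root_.Literature.Probability.LatticeModels.Site.signedPerm_symm_apply (π : Equiv.Perm (Fin d)) (ε : Fin d → ℤˣ)
    (y : LatticeModels.Site d) (j : Fin d) : (LatticeModels.Site.signedPerm π ε).symm y j = (ε (π j) : ℤ) * y (π j) := rfl

/-- The inverse of a signed permutation is a signed permutation. [folklore] -/
theorem _root_.Literature.Probability.LatticeModels.Site.signedPerm_symm (π : Equiv.Perm (Fin d)) (ε : Fin d → ℤˣ) :
    (LatticeModels.Site.signedPerm π ε).symm = LatticeModels.Site.signedPerm π.symm (ε ∘ π) :=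
  Equiv.ext fun y => funext fun j => by simp

/-- Signed permutations fix the origin. [folklore] -/
@[simp] theorem _root_.Literature.Probability.LatticeModels.Site.signedPerm_zero (π : Equiv.Perm (Fin d)) (ε : Fin d → ℤˣ) :
    LatticeModels.Site.signedPerm π ε 0 = 0 := by
  funext i; simp

/-- Signed permutations are additive. [folklore] -/
theorem _root_.Literature.Probability.LatticeModels.Site.signedPerm_add (π : Equiv.Perm (Fin d)) (ε : Fin d → ℤˣ) (x y : LatticeModels.Site d) :
    LatticeModels.Site.signedPerm π ε (x + y) = LatticeModels.Site.signedPerm π ε x + LatticeModels.Site.signedPerm π ε y := by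
  funext i; simp [mul_add]

/-- Signed permutations map unit vectors to signed unit vectors. [folklore] -/
theorem _root_.Literature.Probability.LatticeModels.Site.signedPerm_single (π : Equiv.Perm (Fin d)) (ε : Fin d → ℤˣ) (i : Fin d) :
    LatticeModels.Site.signedPerm π ε (Pi.single i 1) = (ε (π i) : ℤ) • Pi.single (π i) (1 : ℤ) := by
  funext j
  simp only [LatticeModels.Site.signedPerm_apply, Pi.smul_apply, smul_eq_mul]
  rcases eq_or_ne j (π i) with rfl | hj
  · simp
  · have : π.symm j ≠ i := fun h => hj (by rw [← h, Equiv.apply_symm_apply])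
    simp [Pi.single_eq_of_ne this, Pi.single_eq_of_ne hj]

/-- Signed coordinate permutations map neighbours to neighbours. [folklore] -/
theorem zdGraph_adj_signedPerm (π : Equiv.Perm (Fin d)) (ε : Fin d → ℤˣ) {x y : LatticeModels.Site d}
    (h : (LatticeModels.zdGraph d).Adj x y) :
    (LatticeModels.zdGraph d).Adj (LatticeModels.Site.signedPerm π ε x) (LatticeModels.Site.signedPerm π ε y) := by
  rw [LatticeModels.zdGraph_adj_iff] at h ⊢
  obtain ⟨i, h⟩ := h
  refine ⟨π i, ?_⟩
  rcases Int.units_eq_one_or (ε (π i)) with hε | hε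
  · rcases h with rfl | rfl
    · left; rw [LatticeModels.Site.signedPerm_add, LatticeModels.Site.signedPerm_single, hε]; simp
    · right; rw [LatticeModels.Site.signedPerm_add, LatticeModels.Site.signedPerm_single, hε]; simp
  · rcases h with rfl | rfl
    · right
      rw [LatticeModels.Site.signedPerm_add, LatticeModels.Site.signedPerm_single, hε]
      simp [add_assoc]
    · left
      rw [LatticeModels.Site.signedPerm_add, LatticeModels.Site.signedPerm_single, hε]
      simp [add_assoc]

/-- Signed coordinate permutations are automorphisms of `ℤ^d`. [folklore] -/
def zdSignedPermIso (π : Equiv.Perm (Fin d)) (ε : Fin d → ℤˣ) : LatticeModels.zdGraph d ≃g LatticeModels.zdGraph d where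
  toEquiv := LatticeModels.Site.signedPerm π ε
  map_rel_iff' := by
    intro a b
    refine ⟨fun h => ?_, zdGraph_adj_signedPerm π ε⟩
    have := zdGraph_adj_signedPerm π.symm (ε ∘ π) h
    rwa [← LatticeModels.Site.signedPerm_symm, Equiv.symm_apply_apply, Equiv.symm_apply_apply] at this

/-- `zdSignedPermIso` acts by `Site.signedPerm`. [folklore] -/
@[simp] theorem zdSignedPermIso_apply (π : Equiv.Perm (Fin d)) (ε : Fin d → ℤˣ) (x : LatticeModels.Site d) :
    zdSignedPermIso π ε x = LatticeModels.Site.signedPerm π ε x := rfl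

/-- Signed coordinate permutations preserve the boxes `Λ(n)`. [folklore] -/
theorem signedPerm_mem_box_iff (π : Equiv.Perm (Fin d)) (ε : Fin d → ℤˣ) {n : ℕ} {x : LatticeModels.Site d} :
    LatticeModels.Site.signedPerm π ε x ∈ LatticeModels.box d n ↔ x ∈ LatticeModels.box d n := by
  simp only [LatticeModels.mem_box, LatticeModels.Site.signedPerm_apply]
  constructor
  · intro h j
    have := h (π j)
    rw [Equiv.symm_apply_apply] at this
    rcases Int.units_eq_one_or (ε (π j)) with hε | hε <;> rw [hε] at this <;> simp at this <;>
      omega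
  · intro h i
    have := h (π.symm i)
    rcases Int.units_eq_one_or (ε i) with hε | hε <;> rw [hε] <;> simp <;> omega

/-- Signed permutations map `Λ(n)` onto itself. [folklore] -/
theorem signedPerm_image_box (π : Equiv.Perm (Fin d)) (ε : Fin d → ℤˣ) (n : ℕ) :
    (LatticeModels.Site.signedPerm π ε) '' (↑(LatticeModels.box d n) : Set (LatticeModels.Site d)) = ↑(LatticeModels.box d n) := by
  ext y
  constructor
  · rintro ⟨x, hx, rfl⟩
    exact (signedPerm_mem_box_iff π ε).2 hx
  · intro hy
    refine ⟨(LatticeModels.Site.signedPerm π ε).symm y, ?_, Equiv.apply_symm_apply _ _⟩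
    rw [LatticeModels.Site.signedPerm_symm]
    rw [Finset.mem_coe] at hy ⊢
    exact (signedPerm_mem_box_iff _ _).2 hy

end ZdAut

/-! ### Monotonicity, gluing and measurability of connection events -/

section Events

variable (G : SimpleGraph V)

/-- The open subgraph is monotone in the configuration. [folklore] -/
theorem siteOpenGraph_mono {ω ω' : SiteConfig V} (h : ω ⊆ ω') :
    siteOpenGraph G ω ≤ siteOpenGraph G ω' := by
  intro a b hab
  rw [siteOpenGraph_adj] at hab ⊢
  exact ⟨hab.1, h hab.2.1, h hab.2.2⟩

/-- The open subgraph is a subgraph of `G`. [folklore] -/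
theorem siteOpenGraph_le (ω : SiteConfig V) : siteOpenGraph G ω ≤ G :=
  fun _ _ hab => ((siteOpenGraph_adj G ω _ _).1 hab).1

/-- Connection events are increasing. [folklore] -/
theorem siteConnIn_isUpperSet (S : Set V) (x y : V) : IsUpperSet (siteConnIn G S x y) := by
  intro ω ω' hle h
  obtain ⟨hx, hy, hxS, hyS, hr⟩ := h
  exact ⟨hle hx, hle hy, hxS, hyS,
    hr.mono (SimpleGraph.comap_monotone _ (siteOpenGraph_mono G hle))⟩

/-- Connection events are monotone in the constraint set. [folklore] -/
theorem siteConnIn_mono_set {S T : Set V} (hST : S ⊆ T) (x y : V) :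
    siteConnIn G S x y ⊆ siteConnIn G T x y := by
  intro ω h
  simpa using siteConnIn_map (G := G) (G' := G) SimpleGraph.Hom.id (ω := ω)
    (fun v hv => hv) hST h

/-- Connection events are symmetric in the two endpoints. [folklore] -/
theorem siteConnIn_comm (S : Set V) (x y : V) : siteConnIn G S x y = siteConnIn G S y x := by
  ext ω
  constructor <;> rintro ⟨hx, hy, hxS, hyS, hr⟩ <;> exact ⟨hy, hx, hyS, hxS, hr.symm⟩

/-- An open site of `S` is connected to itself in `S`. [folklore] -/
theorem mem_siteConnIn_self {S : Set V} {x : V} {ω : SiteConfig V} (hx : x ∈ ω) (hxS : x ∈ S) :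
    ω ∈ siteConnIn G S x x :=
  ⟨hx, hx, hxS, hxS, SimpleGraph.Reachable.refl _⟩

/-- Two adjacent open sites of `S` are connected in `S`. [folklore] -/
theorem mem_siteConnIn_of_adj {S : Set V} {x y : V} {ω : SiteConfig V} (hx : x ∈ ω) (hy : y ∈ ω)
    (hxS : x ∈ S) (hyS : y ∈ S) (h : G.Adj x y) : ω ∈ siteConnIn G S x y :=
  ⟨hx, hy, hxS, hyS, SimpleGraph.Adj.reachable (by
    simp only [SimpleGraph.comap_adj, Function.Embedding.coe_subtype, siteOpenGraph_adj]
    exact ⟨h, hx, hy⟩)⟩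

/-- **Gluing**: `{x ⟷ y in S} ∩ {y ⟷ z in S'} ⊆ {x ⟷ z in T}` whenever `S, S' ⊆ T`. [folklore] -/
theorem siteConnIn_trans {S S' T : Set V} (hS : S ⊆ T) (hS' : S' ⊆ T) {x y z : V}
    {ω : SiteConfig V} (hxy : ω ∈ siteConnIn G S x y) (hyz : ω ∈ siteConnIn G S' y z) :
    ω ∈ siteConnIn G T x z := by
  obtain ⟨hx, _, hxT, hyT, hr⟩ := siteConnIn_mono_set G hS x y hxy
  obtain ⟨_, hz, _, hzT, hr'⟩ := siteConnIn_mono_set G hS' y z hyz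
  exact ⟨hx, hz, hxT, hzT, hr.trans hr'⟩

/-- The induced open graph on `S` only depends on the configuration inside `S`. [folklore] -/
theorem siteOpenGraph_induce_inter (S : Set V) (ω : SiteConfig V) :
    (siteOpenGraph G (ω ∩ S)).induce S = (siteOpenGraph G ω).induce S := by
  ext a b
  simp only [SimpleGraph.comap_adj, Function.Embedding.coe_subtype, siteOpenGraph_adj,
    Set.mem_inter_iff]
  constructor
  · rintro ⟨h, ⟨ha, -⟩, ⟨hb, -⟩⟩; exact ⟨h, ha, hb⟩
  · rintro ⟨h, ha, hb⟩; exact ⟨h, ⟨ha, a.2⟩, ⟨hb, b.2⟩⟩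

/-- `{x ⟷ y in S}` is determined by the configuration inside `S`. [folklore] -/
theorem mem_siteConnIn_iff_inter (S : Set V) (x y : V) (ω : SiteConfig V) :
    ω ∈ siteConnIn G S x y ↔ ω ∩ S ∈ siteConnIn G S x y := by
  constructor
  · rintro ⟨hx, hy, hxS, hyS, hr⟩
    exact ⟨⟨hx, hxS⟩, ⟨hy, hyS⟩, hxS, hyS, by rwa [siteOpenGraph_induce_inter]⟩
  · rintro ⟨hx, hy, hxS, hyS, hr⟩
    exact ⟨hx.1, hy.1, hxS, hyS, by rwa [siteOpenGraph_induce_inter] at hr⟩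

/-- `{x ⟷ y in S}` is determined by the coordinates in `S` (`DeterminedBy`, so that the local
Harris inequality `sitePercolation_harris` and `DeterminedBy.measurableSet_of_finset` apply).
[folklore] -/
theorem determinedBy_siteConnIn (S : Set V) (x y : V) : DeterminedBy (siteConnIn G S x y) S := by
  rw [determinedBy_iff]
  intro ω ω' h
  rw [mem_siteConnIn_iff_inter G S x y ω, mem_siteConnIn_iff_inter G S x y ω', h]

/-- Connection events inside a finite set are measurable. [folklore] -/
theorem measurableSet_siteConnIn (S : Finset V) (x y : V) :
    MeasurableSet (siteConnIn G (↑S) x y) :=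
  (determinedBy_siteConnIn G (↑S) x y).measurableSet_of_finset

variable {G}

/-- The event that a given site is open is measurable. [folklore] -/
theorem measurableSet_siteOpen (v : V) : MeasurableSet {ω : SiteConfig V | v ∈ ω} :=
  measurableSet_mem v

/-- The event that a given site is open is increasing. [folklore] -/
theorem isUpperSet_siteOpen (v : V) : IsUpperSet {ω : SiteConfig V | v ∈ ω} :=
  fun _ _ hle hv => hle hv

end Events

/-! ### Exit through the inner boundary; `θ ≤ P(x ⟷ ∂ⁱⁿΛ in Λ)` -/

section OpenReach

variable {G : SimpleGraph V}

/-- In the open subgraph, every vertex reachable from an open vertex is open. [folklore] -/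
theorem mem_of_siteOpenGraph_reachable {ω : SiteConfig V} {a b : V}
    (h : (siteOpenGraph G ω).Reachable a b) (ha : a ∈ ω) : b ∈ ω := by
  rw [SimpleGraph.reachable_iff_reflTransGen] at h
  induction h with
  | refl => exact ha
  | tail _ hcb _ => exact ((siteOpenGraph_adj G ω _ _).1 hcb).2.2

end OpenReach

section Exit

variable {G : SimpleGraph V} [DecidableEq V] [G.LocallyFinite]

/-- A walk in a subgraph `H ≤ G` from a vertex of `Λ` to a vertex outside `Λ` passes through the
inner vertex boundary of `Λ`, and its initial segment up to that point stays inside `Λ`.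
[folklore] -/
theorem exists_innerBoundary_reachable_of_walk {H : SimpleGraph V} (hH : H ≤ G) (Λ : Finset V) :
    ∀ {u v : V} (_ : H.Walk u v), u ∈ Λ → v ∉ Λ →
      ∃ b ∈ LatticeModels.innerBoundary G Λ, ∃ (hu : u ∈ (↑Λ : Set V)) (hb : b ∈ (↑Λ : Set V)),
        (H.induce (↑Λ : Set V)).Reachable ⟨u, hu⟩ ⟨b, hb⟩ := by
  intro u v w
  induction w with
  | nil => intro hu hv; exact absurd hu hv
  | @cons a c _ hac w ih =>
    intro ha hv
    by_cases hc : c ∈ Λ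
    · obtain ⟨b, hb, hcΛ, hbΛ, hr⟩ := ih hc hv
      refine ⟨b, hb, ha, hbΛ, SimpleGraph.Reachable.trans (SimpleGraph.Adj.reachable ?_) hr⟩
      simpa [SimpleGraph.comap_adj] using hac
    · refine ⟨a, ?_, ha, ha, SimpleGraph.Reachable.refl _⟩
      rw [LatticeModels.mem_innerBoundary_iff]
      exact ⟨ha, c, hc, hH hac⟩

/-- **`{|C(x)| = ∞} ⊆ {x ⟷ ∂ⁱⁿΛ in Λ}`** for a finite `Λ ∋ x`: an infinite open cluster leaves every
finite set, and does so through the inner boundary. [folklore] -/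
theorem sitePercolatesAt_subset_iUnion_siteConnIn (Λ : Finset V) {x : V} (hx : x ∈ Λ) :
    sitePercolatesAt G x ⊆ ⋃ b ∈ LatticeModels.innerBoundary G Λ, siteConnIn G (↑Λ) x b := by
  intro ω hω
  have hinf : (siteCluster G ω x).Infinite := hω
  obtain ⟨v, hv, hvΛ⟩ := hinf.exists_notMem_finset Λ
  obtain ⟨hxω, _, hr⟩ := hv
  obtain ⟨w⟩ := hr
  obtain ⟨b, hb, hxΛ, hbΛ, hreach⟩ :=
    exists_innerBoundary_reachable_of_walk (siteOpenGraph_le G ω) Λ w hx hvΛ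
  simp only [Set.mem_iUnion, exists_prop]
  refine ⟨b, hb, hxω, ?_, hxΛ, hbΛ, hreach⟩
  have : (siteOpenGraph G ω).Reachable x b :=
    hreach.map (SimpleGraph.Embedding.induce (↑Λ : Set V)).toHom
  exact mem_of_siteOpenGraph_reachable this hxω

/-- **`θ_x(p) ≤ Σ_{b ∈ ∂ⁱⁿΛ} P_p(x ⟷ b in Λ)`** for a finite `Λ ∋ x` (union bound). [folklore] -/
theorem siteTheta_le_sum_siteConnIn (p : unitInterval) (Λ : Finset V) {x : V} (hx : x ∈ Λ) :
    siteTheta G x p ≤ ∑ b ∈ LatticeModels.innerBoundary G Λ, (sitePercolation V p).real (siteConnIn G (↑Λ) x b) := by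
  unfold siteTheta
  calc (sitePercolation V p).real (sitePercolatesAt G x)
      ≤ (sitePercolation V p).real (⋃ b ∈ LatticeModels.innerBoundary G Λ, siteConnIn G (↑Λ) x b) :=
        measureReal_mono (sitePercolatesAt_subset_iUnion_siteConnIn Λ hx) (measure_ne_top _ _)
    _ ≤ ∑ b ∈ LatticeModels.innerBoundary G Λ, (sitePercolation V p).real (siteConnIn G (↑Λ) x b) :=
        measureReal_biUnion_finset_le _ _

/-- Pigeonhole form: some boundary site carries at least the average. [folklore] -/
theorem exists_innerBoundary_siteConnIn_ge (p : unitInterval) (Λ : Finset V) {x : V} (hx : x ∈ Λ)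
    (hθ : 0 < siteTheta G x p) :
    ∃ b ∈ LatticeModels.innerBoundary G Λ, siteTheta G x p / (LatticeModels.innerBoundary G Λ).card ≤
      (sitePercolation V p).real (siteConnIn G (↑Λ) x b) := by
  have hsum := siteTheta_le_sum_siteConnIn (G := G) p Λ hx
  have hne : (LatticeModels.innerBoundary G Λ).Nonempty := by
    rw [Finset.nonempty_iff_ne_empty]
    rintro h
    rw [h, Finset.sum_empty] at hsum
    exact absurd hsum (not_le.2 hθ)
  have hsum' : ∑ _b ∈ LatticeModels.innerBoundary G Λ, siteTheta G x p / (LatticeModels.innerBoundary G Λ).card ≤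
      ∑ b ∈ LatticeModels.innerBoundary G Λ, (sitePercolation V p).real (siteConnIn G (↑Λ) x b) := by
    rw [Finset.sum_const, nsmul_eq_mul, mul_div_cancel₀]
    · exact hsum
    · exact_mod_cast hne.card_pos.ne'
  exact Finset.exists_le_of_sum_le hne hsum'

end Exit

/-! ### Geometry of the boxes `Λ(n) ⊆ ℤ^d` -/

section ZdBox

variable {d : ℕ}

/-- Every site of `Λ(n)` is joined to the origin by a nearest-neighbour path inside `Λ(n)`
(move one coordinate towards `0` at a time). [folklore] -/
theorem box_induce_reachable_zero (n : ℕ) {x : LatticeModels.Site d} (hx : x ∈ LatticeModels.box d n) :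
    ((LatticeModels.zdGraph d).induce (↑(LatticeModels.box d n) : Set (LatticeModels.Site d))).Reachable ⟨x, hx⟩ ⟨0, LatticeModels.zero_mem_box d n⟩ := by
  suffices H : ∀ m : ℕ, ∀ x : LatticeModels.Site d, ∀ hx : x ∈ LatticeModels.box d n, ∑ i, (x i).natAbs = m →
      ((LatticeModels.zdGraph d).induce (↑(LatticeModels.box d n) : Set (LatticeModels.Site d))).Reachable ⟨x, hx⟩ ⟨0, LatticeModels.zero_mem_box d n⟩ from
    H _ x hx rfl
  intro m
  induction m using Nat.strong_induction_on with
  | _ m ih =>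
    intro x hx hm
    by_cases h0 : x = 0
    · subst h0; rfl
    · obtain ⟨i, hi⟩ : ∃ i, x i ≠ 0 := by
        by_contra h
        push Not at h
        exact h0 (funext h)
      have hxi := (LatticeModels.mem_box.1 hx) i
      set v : ℤ := if 0 < x i then x i - 1 else x i + 1 with hv
      set x' : LatticeModels.Site d := Function.update x i v with hx'
      have hx'j : ∀ j, j ≠ i → x' j = x j := fun j hj => by simp [hx', hj]
      have hx'i : x' i = v := by simp [hx']
      have hx'box : x' ∈ LatticeModels.box d n := by
        rw [LatticeModels.mem_box] at hx ⊢
        intro j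
        rcases eq_or_ne j i with rfl | hj
        · rw [hx'i, hv]; split_ifs <;> omega
        · rw [hx'j j hj]; exact hx j
      have hadj : (LatticeModels.zdGraph d).Adj x x' := by
        rw [LatticeModels.zdGraph_adj_iff]
        refine ⟨i, ?_⟩
        by_cases hpos : 0 < x i
        · right
          funext j
          rcases eq_or_ne j i with rfl | hj
          · simp [hx'i, hv, hpos]
          · simp [hx'j j hj, hj]
        · left
          funext j
          rcases eq_or_ne j i with rfl | hj
          · simp [hx'i, hv, hpos]
          · simp [hx'j j hj, hj]
      have hlt : ∑ j, (x' j).natAbs < m := by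
        rw [← hm]
        apply Finset.sum_lt_sum
        · intro j _
          rcases eq_or_ne j i with rfl | hj
          · rw [hx'i, hv]; split_ifs <;> omega
          · rw [hx'j j hj]
        · refine ⟨i, Finset.mem_univ _, ?_⟩
          rw [hx'i, hv]; split_ifs <;> omega
      have hadj' : ((LatticeModels.zdGraph d).induce (↑(LatticeModels.box d n) : Set (LatticeModels.Site d))).Adj ⟨x, hx⟩ ⟨x', hx'box⟩ := by
        simpa [SimpleGraph.comap_adj] using hadj
      exact hadj'.reachable.trans (ih _ hlt x' hx'box rfl)


/-- Any two sites of `Λ(n)` are joined by a nearest-neighbour path inside `Λ(n)`. [folklore] -/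
theorem box_induce_reachable (n : ℕ) {x y : LatticeModels.Site d} (hx : x ∈ LatticeModels.box d n) (hy : y ∈ LatticeModels.box d n) :
    ((LatticeModels.zdGraph d).induce (↑(LatticeModels.box d n) : Set (LatticeModels.Site d))).Reachable ⟨x, hx⟩ ⟨y, hy⟩ :=
  (box_induce_reachable_zero n hx).trans (box_induce_reachable_zero n hy).symm

/-- If all sites of `Λ(n)` are open then any two of them are connected inside `Λ(n)`. [folklore] -/
theorem mem_siteConnIn_box_of_subset (n : ℕ) {x y : LatticeModels.Site d} (hx : x ∈ LatticeModels.box d n) (hy : y ∈ LatticeModels.box d n)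
    {ω : SiteConfig (LatticeModels.Site d)} (hω : (↑(LatticeModels.box d n) : Set (LatticeModels.Site d)) ⊆ ω) :
    ω ∈ siteConnIn (LatticeModels.zdGraph d) ↑(LatticeModels.box d n) x y := by
  refine ⟨hω hx, hω hy, hx, hy, ?_⟩
  have hle : (LatticeModels.zdGraph d).induce (↑(LatticeModels.box d n) : Set (LatticeModels.Site d)) ≤
      (siteOpenGraph (LatticeModels.zdGraph d) ω).induce (↑(LatticeModels.box d n) : Set (LatticeModels.Site d)) := by
    intro a b hab
    simp only [SimpleGraph.comap_adj, Function.Embedding.coe_subtype, siteOpenGraph_adj] at hab ⊢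
    exact ⟨hab, hω a.2, hω b.2⟩
  exact (box_induce_reachable n hx hy).mono hle

/-- **Positivity**: `P_p(x ⟷ y in Λ(n)) ≥ p ^ |Λ(n)|` for `x, y ∈ Λ(n)`. [folklore] -/
theorem pow_card_box_le_siteConnIn (p : unitInterval) (n : ℕ) {x y : LatticeModels.Site d} (hx : x ∈ LatticeModels.box d n)
    (hy : y ∈ LatticeModels.box d n) :
    (p : ℝ) ^ (LatticeModels.box d n).card ≤
      (sitePercolation (LatticeModels.Site d) p).real (siteConnIn (LatticeModels.zdGraph d) ↑(LatticeModels.box d n) x y) := by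
  rw [← sitePercolation_real_subset p (LatticeModels.box d n)]
  exact measureReal_mono (fun ω hω => mem_siteConnIn_box_of_subset n hx hy hω)
    (measure_ne_top _ _)

/-- A site of the inner boundary of `Λ(n)` lies on a face `{x_i = ±n}`. [folklore] -/
theorem exists_eq_of_mem_innerBoundary_box {n : ℕ} {x : LatticeModels.Site d}
    (hx : x ∈ LatticeModels.innerBoundary (LatticeModels.zdGraph d) (LatticeModels.box d n)) : ∃ i, x i = n ∨ x i = -n := by
  rw [LatticeModels.mem_innerBoundary_iff] at hx
  obtain ⟨hx, y, hy, hxy⟩ := hx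
  rw [LatticeModels.mem_box] at hx hy
  push Not at hy
  obtain ⟨j, hj⟩ := hy
  rw [LatticeModels.zdGraph_adj_iff] at hxy
  obtain ⟨i, h | h⟩ := hxy
  · have hyj : y j = x j + (Pi.single i (1 : ℤ) : LatticeModels.Site d) j := by rw [h]; rfl
    refine ⟨j, ?_⟩
    rcases eq_or_ne j i with rfl | hji
    · simp at hyj; have := hx j; omega
    · simp [hji] at hyj; have := hx j; omega
  · have hxj : x j = y j + (Pi.single i (1 : ℤ) : LatticeModels.Site d) j := by rw [h]; rfl
    refine ⟨j, ?_⟩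
    rcases eq_or_ne j i with rfl | hji
    · simp at hxj; have := hx j; omega
    · simp [hji] at hxj; have := hx j; omega

/-- The face `{x ∈ Λ(n) : x_i = c}` has at most `(2n+1)^{d-1}` sites. [folklore] -/
theorem card_filter_box_apply_eq_le (n : ℕ) (i : Fin d) (c : ℤ) :
    ((LatticeModels.box d n).filter fun x => x i = c).card ≤ (2 * n + 1) ^ (d - 1) := by
  classical
  calc ((LatticeModels.box d n).filter fun x => x i = c).card
      ≤ (Fintype.piFinset fun j => if j = i then ({c} : Finset ℤ) else Finset.Icc (-(n : ℤ)) n).card := by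
        refine Finset.card_le_card fun x hx => ?_
        rw [Finset.mem_filter, LatticeModels.mem_box] at hx
        rw [Fintype.mem_piFinset]
        intro j
        split_ifs with hj
        · subst hj; simp [hx.2]
        · exact Finset.mem_Icc.2 (hx.1 j)
    _ = (2 * n + 1) ^ (d - 1) := by
        rw [Fintype.card_piFinset]
        simp only [apply_ite Finset.card, Finset.card_singleton, Int.card_Icc]
        rw [Finset.prod_ite, Finset.prod_const_one, one_mul, Finset.prod_const,
          Finset.filter_ne' Finset.univ i, Finset.card_erase_of_mem (Finset.mem_univ i),
          Finset.card_univ, Fintype.card_fin]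
        congr 1; omega

/-- **`|∂ⁱⁿΛ(n)| ≤ 2d(2n+1)^{d-1}`** (Cerf 2015, §6/§10). [folklore] -/
theorem card_innerBoundary_box_le (n : ℕ) :
    (LatticeModels.innerBoundary (LatticeModels.zdGraph d) (LatticeModels.box d n)).card ≤ 2 * d * (2 * n + 1) ^ (d - 1) := by
  classical
  have hsub : LatticeModels.innerBoundary (LatticeModels.zdGraph d) (LatticeModels.box d n) ⊆ Finset.univ.biUnion fun i : Fin d =>
      ((LatticeModels.box d n).filter fun x => x i = (n : ℤ)) ∪ ((LatticeModels.box d n).filter fun x => x i = -(n : ℤ)) := by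
    intro x hx
    have hxbox : x ∈ LatticeModels.box d n := (LatticeModels.mem_innerBoundary_iff.1 hx).1
    obtain ⟨i, hi⟩ := exists_eq_of_mem_innerBoundary_box hx
    simp only [Finset.mem_biUnion, Finset.mem_univ, true_and, Finset.mem_union,
      Finset.mem_filter]
    exact ⟨i, hi.imp (fun h => ⟨hxbox, h⟩) (fun h => ⟨hxbox, h⟩)⟩
  calc (LatticeModels.innerBoundary (LatticeModels.zdGraph d) (LatticeModels.box d n)).card
      ≤ (Finset.univ.biUnion fun i : Fin d =>
          ((LatticeModels.box d n).filter fun x => x i = (n : ℤ)) ∪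
            ((LatticeModels.box d n).filter fun x => x i = -(n : ℤ))).card :=
        Finset.card_le_card hsub
    _ ≤ ∑ i : Fin d, (((LatticeModels.box d n).filter fun x => x i = (n : ℤ)) ∪
          ((LatticeModels.box d n).filter fun x => x i = -(n : ℤ))).card := Finset.card_biUnion_le
    _ ≤ ∑ _i : Fin d, 2 * (2 * n + 1) ^ (d - 1) := by
        refine Finset.sum_le_sum fun i _ => (Finset.card_union_le _ _).trans ?_
        have h1 := card_filter_box_apply_eq_le n i (n : ℤ)
        have h2 := card_filter_box_apply_eq_le n i (-(n : ℤ))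
        omega
    _ = 2 * d * (2 * n + 1) ^ (d - 1) := by
        rw [Finset.sum_const, Finset.card_univ, Fintype.card_fin, smul_eq_mul]; ring

/-- Translates of boxes: `(x ↦ x + v) '' Λ(n)`. [folklore] -/
theorem zdShiftIso_image_box (v : LatticeModels.Site d) (n : ℕ) :
    (zdShiftIso v) '' (↑(LatticeModels.box d n) : Set (LatticeModels.Site d)) = ↑((LatticeModels.box d n).image (· + v)) := by
  rw [Finset.coe_image]; rfl

/-- A translate of `Λ(n)` by a vector of `Λ(k)` lies in `Λ(k + n)`. [folklore] -/
theorem image_add_box_subset {v : LatticeModels.Site d} {k n : ℕ} (hv : v ∈ LatticeModels.box d k) :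
    (LatticeModels.box d n).image (· + v) ⊆ LatticeModels.box d (k + n) := by
  intro y hy
  rw [Finset.mem_image] at hy
  obtain ⟨x, hx, rfl⟩ := hy
  rw [LatticeModels.mem_box] at hx hv ⊢
  intro i
  have h1 := hx i; have h2 := hv i
  simp only [Pi.add_apply, Nat.cast_add]
  omega

/-- Signed permutations act transitively on the signed coordinate axes: `a e_i ↦ (s a) e_j`.
[folklore] -/
theorem exists_signedPerm_single (i j : Fin d) (s : ℤˣ) (a : ℤ) :
    ∃ (π : Equiv.Perm (Fin d)) (ε : Fin d → ℤˣ),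
      LatticeModels.Site.signedPerm π ε (Pi.single i a) = Pi.single j ((s : ℤ) * a) := by
  refine ⟨Equiv.swap i j, fun _ => s, funext fun k => ?_⟩
  simp only [LatticeModels.Site.signedPerm_apply, Equiv.symm_swap]
  rcases eq_or_ne k j with rfl | hk
  · simp
  · rw [Pi.single_eq_of_ne hk]
    rcases eq_or_ne k i with rfl | hki
    · rw [Equiv.swap_apply_left, Pi.single_eq_of_ne (Ne.symm hk), mul_zero]
    · rw [Equiv.swap_apply_of_ne_of_ne hki hk, Pi.single_eq_of_ne hki, mul_zero]

end ZdBox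

end Literature.Probability.Percolation
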